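import Summits.QuantumFields.YangMills.Theorems.BalabanUVNodesN22W1RelCentredHeredity

/-!
# BalabanUVNodes ∕ node N22 = NE9 — THE W1 OBJECT ON THE RELATIVE-DISC CENTRED ROAD (RE-TYPING M1′), MODULE R1b: CENTRED HEREDITY — the order-two VERTEX LETTER of
# every generated term in every young coupling w.r.t. the VERTEX TOWER, from the per-term vertex schema (S-vertex-T′), by an INTERPOLATION TOWER — growth μ = 1

Cell `pub-ymgap`, HUMAN RULING D-0062 (Track A), R134 ACCELERATION re-seat `pub-ymgap-dag-n22-c` (strategy s1), generation 6, file R1b of the re-typed line.  THEOREMS ONLY; imports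
module R1a `…N22W1RelCentredHeredity` (§1 `holoBound_E_ofTerms_of_termwise`, §2 `holoBound_recTerm_ofTerms` — uncentred heredity on any domain family) BY NAME.  `--supports` K3⁗
`SpineGivenEndpointR13Sep` (stmt-QuantumFields-20292) as a helper.

WHY.  Module R0's slot (A₂ᶜ) wants, besides holomorphy on the relative discs (R1a), the CENTRED order-two letter ‖F z − e₀‖ ≤ M·μ^{age}·t²·e^{−κd}.  THIS FILE derives it for every
generated term from the NEW per-term VERTEX schema (S-vertex-T′): a coupling-BLIND centre functional `V k′ Z t old φ` per step (the one-sided limit of the term at zero coupling —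
lens T13′: typed FREE, never as the evaluation at `s = 0`, which is Lean junk under the thresholds `ε₁∕‖s‖` of record), obeying (S-226-T′) like `TF`, with the centred letter
‖TF k′ Z t z old φ − V k′ Z t old φ‖ ≤ Mv·‖z‖²·weight(t)·e^{a₅|Z|} on `D k′` for every (1.18)-bounded older-term family (order two in `g` = order one in `s = g²`: [I] (2.13) p. 268
«vanishes at `g_k = 0`» + the parity `(g, B) ↦ (−g, −B)` of the (2.14) terms, lens T5∕T14; p. 263 «C^∞ (or analytic)» made QUANTITATIVE at complex coupling — NOT PRINTED).  OUTPUT: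
for every level `j ≤ Kr`, young coupling `i < j`, `z₀ ∈ D i` (`z₀ ≠ 0`, `Mv‖z₀‖² ≤ ½`): ‖recTerm G (↑g|i:=z₀) j X φ − recTerm G_V ↑g j X φ‖ ≤ 2·Mv·‖z₀‖²·A·e^{−κ d_j(X)}, where
`G_V := GenTower.ofTerms L (TF | i := V i)` is the VERTEX TOWER of the coupling `g_i` (its terms do not read `g_i`) — UNIFORMLY IN THE AGE `j − i` (growth μ = 1).
MECHANISM: the INTERPOLATION TOWER `TF | i := (V i + (s∕ρ)·(TF i …z₀… − V i))`, `ρ := γ + 1`, is a term-functional family in its own right: affine (hence entire) in the mock coupling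
`s`, with weight at most DOUBLED on `ball 0 (ρ∕(Mv‖z₀‖²))` by the centred letter — the displayed slack `2·e^{a₅|Z|} ≤ e^{a₅′|Z|}`, the socket numerals asked at `a₅′`; R1a §2 applies to
it with the coupling-`i` domain replaced by that ball, so its level-`j` section in the mock coupling is holomorphic there and bounded by R1a's LEVEL-UNIFORM renewal amplitude
`A·e^{−κd}`; §1 identifies that section at `s = ρ` with the true section at `g_i = z₀` and at `s = 0` with the vertex tower's term; the Schwarz lemma on the ball gives the letter.
No product of per-level Lipschitz constants forms: the interpolation rides the renewal bound at the TOP level directly.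

INHABITATION NOTE (lens g9 rider V′, bus 2026-08-27 07:07Z).  The own-coupling socket (S-last-T′) asks holomorphy of `z ↦ TF k′ Z t z old φ` for the ABSTRACT family `TF` of this
file: it is inhabited by the ANALYTICALLY CONTINUED term functional (pre-scaling display [I] (2.10) p. 267, temperature `τ = 1∕g²`; lens T14), NOT by a box-keyed formula read at complex
coupling (thresholds `ε₁∕‖s‖` are real-valued in `s`, so `∂_{s̄} ≠ 0` already at window points).  The leaf (module R2) therefore displays these schemas for a CONTINUED family
`TFc` that AGREES WITH THE DATUM's `TF` ON THE REAL WINDOW — the generated towers then have the same real-history terms (§3-type congruence), which is all the reading sees.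

HONEST FRAMING.  Count-neutral by-name knit AT THE OBJECT; NOT a discharge of N22.  (S-last-T′), (S-226-T′) (for `TF` and for the centre `V`), (S-vertex-T′) are DISPLAYED hypotheses on
the term functional of record and asserted nowhere; (S-vertex-T′) is NE9's unprinted core at the last coupling in the weakest analytic currency; NE9 NOT IN PRINT for d = 4; one finite
four-torus programme at fixed ε — NOT infinite volume, NOT OS on ℝ⁴, NOT a mass gap, NOT Clay.  0 `sorry`, 0 `def`, standard axioms.

References (TYPES only): [I] = [Balaban1987RG1] §0 p. 256, §1 p. 263, (2.9) p. 266, (2.10) p. 267, (2.13) p. 268; [II] = [Balaban1988RG2Cluster] (1.41) p. 11, (2.9)–(2.14) pp. 14–15,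
(2.26) p. 17, Lemma 3 (2.38) p. 20, (2.39)–(2.41) p. 21.
-/

noncomputable section

namespace YMDAG.N22.W1

open Set Metric
open scoped BigOperators
open Literature.MathematicalPhysics.QuantumFieldTheory.Balaban1983to89
open Literature.MathematicalPhysics.QuantumFieldTheory.Balaban1983to89.T4Continuum (T4Family)
open Literature.MathematicalPhysics.QuantumFieldTheory.Balaban1983to89.T4OutputRate
open Literature.MathematicalPhysics.QuantumFieldTheory.Balaban1983to89.TreeLengthTorus (TPt TDom tsys torusTreeLen torusTreeLen_nonneg)
open Literature.MathematicalPhysics.QuantumFieldTheory.Balaban1983to89.B12TreeDecay (K₀ K₀_pos)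
open Literature.MathematicalPhysics.QuantumFieldTheory.Balaban1983to89.B13Lemma3TorusData (TBond)
open Literature.MathematicalPhysics.QuantumFieldTheory.Balaban1983to89.B13Lemma3TorusTerms (terms weight weight_nonneg)
open Literature.MathematicalPhysics.QuantumFieldTheory.Balaban1983to89.B13Lemma3TorusSocket (Lemma3Numerics)
open Literature.MathematicalPhysics.QuantumFieldTheory.Balaban1983to89.Node00
open Literature.MathematicalPhysics.QuantumFieldTheory.Balaban1983to89.Node00.Sect2 (domSys domCount CPair)
open Literature.MathematicalPhysics.QuantumFieldTheory.Balaban1983to89.Node00.W1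

variable (F : T4Family) (K : ℕ) {𝔸 : Type*} {M : ℕ} [NeZero M] (L : ℕ) [NeZero L]

/-! ## §1 Congruences of the term-indexed recursion: a tower changed at ONE step, a history changed at ONE coupling -/

open Classical in
/-- **(2.13) of the term-indexed generator depends on the term VALUES only**: two term functionals taking the same values at `(t, old, φ)` resp. `(t′, old′, φ′)` on the terms of
every `Z` create the same `E^{(k+1)}(X)` (`ofTerms_E`: one `locE` literal over the term sums). [cite: Balaban1988RG2Cluster, (2.13)-(2.14) pp.14-15 (bookkeeping)] -/
theorem E_ofTerms_congr {k : ℕ} {T T' : TermFun (F.P K) 𝔸 M k L} {t t' : ℂ} {old old' : OlderTerms (F.P K) 𝔸 M k} {φ φ' : CPair (F.P K) 𝔸}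
    (X : (domSys (F.P K) M (k + 1)).Dom) (h : ∀ (Z : (domSys (F.P K) M (k + 1)).Dom), ∀ s ∈ terms L M Z, T Z s t old φ = T' Z s t' old' φ') :
    (StepGen.ofTerms L T).E t old φ X = (StepGen.ofTerms L T').E t' old' φ' X := by
  rw [ofTerms_E, ofTerms_E]
  exact congrArg (fun w => B13Resummation.locE _ _ w (Subtype.val X)) (funext fun Z => Finset.sum_congr rfl (h Z))

open Classical in
/-- **A TOWER CHANGED AT ONE STEP, READ AT A HISTORY CHANGED AT THAT STEP's COUPLING**: if two term-functional families agree at every step `k′ ≠ i`, two (complex) histories agree at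
every coupling `n ≠ i`, and at step `i` the two term functionals take the same values at the respective last couplings `h₁ i`, `h₂ i` (for all older terms and configurations), then
the two generated towers have the same terms at every level (the levels `≤ i` read neither the step `i` nor the coupling `g_i`; level `i + 1` by the step-`i` agreement; the higher
levels by induction through the older terms).  The interpolation tower of §2 at its two mock couplings is identified with the true tower and with the vertex tower by this lemma (§2).
[cite: Balaban1987RG1, §0 p.256 and (2.13) p.268 (bookkeeping)] -/
theorem recTerm_ofTerms_congr_step {TF₁ TF₂ : GenTermFun (F.P K) 𝔸 M L} {h₁ h₂ : ℕ → ℂ} (i : ℕ) (hT : ∀ k' : ℕ, k' ≠ i → TF₁ k' = TF₂ k')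
    (hh : ∀ n : ℕ, n ≠ i → h₁ n = h₂ n)
    (hi : ∀ (Z : (domSys (F.P K) M (i + 1)).Dom) (t : TermLabel (F.P K) M i L) (old : OlderTerms (F.P K) 𝔸 M i) (φ : CPair (F.P K) 𝔸),
      TF₁ i Z t (h₁ i) old φ = TF₂ i Z t (h₂ i) old φ) :
    ∀ (j : ℕ) (X : (domSys (F.P K) M j).Dom) (φ : CPair (F.P K) 𝔸),
      recTerm (GenTower.ofTerms L TF₁) h₁ j X φ = recTerm (GenTower.ofTerms L TF₂) h₂ j X φ := by
  intro j
  induction j using Nat.strong_induction_on with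
  | _ j ih =>
    intro X φ
    cases j with
    | zero => simp
    | succ k =>
      rw [recTerm_succ, recTerm_succ]
      have hold : olderOf (recTerm (GenTower.ofTerms L TF₁) h₁) k = olderOf (recTerm (GenTower.ofTerms L TF₂) h₂) k :=
        funext fun j' => funext fun Y => funext fun ψ => ih j'.1 j'.2 Y ψ
      rw [hold]
      by_cases hk : k = i
      · subst hk
        exact E_ofTerms_congr F K L X fun Z s _ => hi Z s _ φ
      · show (StepGen.ofTerms L (TF₁ k)).E (h₁ k) _ φ X = (StepGen.ofTerms L (TF₂ k)).E (h₂ k) _ φ X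
        rw [hT k hk, hh k hk]

open Classical in
/-- **TWO TERM-FUNCTIONAL FAMILIES AGREEING AT THE COUPLINGS OF ONE HISTORY GENERATE THE SAME TERMS AT THAT HISTORY** (all steps; e.g. a CONTINUED family and the datum's,
agreeing on the real window, read at a real window history — the leaf's identification of the canonical complexification with the reading's functional).
[cite: Balaban1987RG1, §0 p.256 and (2.13) p.268 (bookkeeping)] -/
theorem recTerm_ofTerms_congr_couplings {TF₁ TF₂ : GenTermFun (F.P K) 𝔸 M L} {h : ℕ → ℂ}
    (hT : ∀ (k' : ℕ) (Z : (domSys (F.P K) M (k' + 1)).Dom) (t : TermLabel (F.P K) M k' L) (old : OlderTerms (F.P K) 𝔸 M k') (φ : CPair (F.P K) 𝔸),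
      TF₁ k' Z t (h k') old φ = TF₂ k' Z t (h k') old φ) :
    ∀ (j : ℕ) (X : (domSys (F.P K) M j).Dom) (φ : CPair (F.P K) 𝔸),
      recTerm (GenTower.ofTerms L TF₁) h j X φ = recTerm (GenTower.ofTerms L TF₂) h j X φ := by
  intro j
  induction j using Nat.strong_induction_on with
  | _ j ih =>
    intro X φ
    cases j with
    | zero => simp
    | succ k =>
      rw [recTerm_succ, recTerm_succ]
      have hold : olderOf (recTerm (GenTower.ofTerms L TF₁) h) k = olderOf (recTerm (GenTower.ofTerms L TF₂) h) k :=
        funext fun j' => funext fun Y => funext fun ψ => ih j'.1 j'.2 Y ψ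
      rw [hold]
      exact E_ofTerms_congr F K L X fun Z s _ => hT k Z s _ φ

/-! ## §2 CENTRED HEREDITY: the order-two vertex letter of every generated term in every young coupling, w.r.t. the vertex tower — growth μ = 1 -/

open Classical in
/-- **THE CENTRED LETTER OF EVERY LEVEL FROM THE PER-TERM VERTEX SCHEMA, BY THE INTERPOLATION TOWER.**  Setting of R1a §2 at the letter `a₅′` (the socket numerals are asked at `a₅′`, the
per-term weight bounds displayed at `a₅` with the slack `2·e^{a₅|Z|} ≤ e^{a₅′|Z|}` — one letter of room for the interpolation), PLUS: a coupling-BLIND centre functional `V k′ Z t old φ`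
per step (the one-sided limit of the term at zero coupling — lens T13′: typed FREE, never as the evaluation at `s = 0`), (S-226-T′) for `TF` at every complex last coupling `u ∈ D k′` AND for
`V`, both on EVERY open set along every holomorphic (1.18)-bounded older-term curve (structural), and the CENTRED half of (S-vertex-T′): ‖TF k′ Z t z old φ − V k′ Z t old φ‖ ≤
Mv·‖z‖²·weight(t)·e^{a₅|Z|} for `z ∈ D k′` and every (1.18)-bounded older-term family (order two in `g`: [I] (2.13) p. 268 «vanishes at `g_k = 0`» + parity `(g, B) ↦ (−g, −B)`, lens
T5∕T14 — NOT PRINTED).  CONCLUSION: at every level `j ≤ Kr`, real window history `g`, young coupling `i < j`, `X`, `φ ∈ sp j X` and `z₀ ∈ D i` with `0 < Mv`, `z₀ ≠ 0`,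
`Mv·‖z₀‖² ≤ ½`: ‖recTerm G (↑g|i:=z₀) j X φ − recTerm G_V ↑g j X φ‖ ≤ 2·Mv·‖z₀‖²·A·e^{−κ d_j(X)}, where `G_V := GenTower.ofTerms L (TF | i := V i)` is the VERTEX TOWER for the
coupling `g_i` (its terms do not read `g_i`) — UNIFORMLY IN THE AGE `j − i`.  Proof: the interpolation tower `TF | i := (V i + (s∕ρ)·(TF i …z₀… − V i))`, `ρ := γ + 1`, is a
term-functional family to which R1a §2 applies with the domain of the coupling `i` replaced by `ball 0 (ρ∕(Mv‖z₀‖²))` (affine in the mock coupling; weight at most doubled there by the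
centred letter — the displayed slack); its level-`j` section in the mock coupling is holomorphic on that ball and bounded by `A·e^{−κd}` (R1a §2), equals the true section at `g_i = z₀` at
the mock coupling `ρ` and the vertex tower's term at `0` (§1); the Schwarz lemma on the ball gives the letter. [cite: Balaban1987RG1, §0 p.256, §1 p.263, (2.9) p.266, (2.10) p.267 and (2.13) p.268; Balaban1988RG2Cluster, (1.41) p.11, (2.14) p.15, (2.26) p.17 and (2.39)-(2.41) p.21] -/
theorem centred_recTerm_ofTerms (TF : GenTermFun (F.P K) 𝔸 M L)
    (V : (k : ℕ) → (domSys (F.P K) M (k + 1)).Dom → TermLabel (F.P K) M k L → OlderTerms (F.P K) 𝔸 M k → CPair (F.P K) 𝔸 → ℂ)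
    (sp : (j : ℕ) → (domSys (F.P K) M j).Dom → Set (CPair (F.P K) 𝔸))
    (c : B13.Consts) (hL : 8 ≤ c.L) (hLc : c.L = L) {a a₂ a₂' a₅ a₅' Aabs : ℝ} (hN : Lemma3Numerics c M ((c.L : ℝ) / 2) a a₂ a₂' a₅' Aabs)
    {γ A κ r₁ Mv : ℝ} (hA0 : 0 ≤ c.C3act * c.ε₁) (hr₁ : 0 ≤ r₁) (hκ : κ ≤ r₁)
    (hrate : r₁ + 2 * (64 * Real.log 162) + 2 ≤ (1 - 8 * c.δ) * ((c.L : ℝ) / 2) * c.κ)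
    (hsmall : c.C3act * c.ε₁ * Real.exp (5 * r₁ + 1) * K₀ 64 8 * 9 * 64 ≤ 1)
    (hrenew : Real.exp 1 * 9 * 64 * K₀ 64 8 ^ 2 * (c.C3act * c.ε₁) ≤ A)
    (h2w : ∀ (k' : ℕ) (Z : (domSys (F.P K) M (k' + 1)).Dom), 2 * Real.exp (a₅ * ((Z.1).card : ℝ)) ≤ Real.exp (a₅' * ((Z.1).card : ℝ)))
    (D : ℕ → Set ℂ) (hDo : ∀ i, IsOpen (D i)) (hDw : ∀ (i : ℕ), ∀ t ∈ Ioc (0 : ℝ) γ, ((t : ℝ) : ℂ) ∈ D i) (Kr : ℕ)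
    (hlast : ∀ k' : ℕ, k' < Kr → ∀ old : OlderTerms (F.P K) 𝔸 M k',
      (∀ (j : Fin (k' + 1)) (Y : (domSys (F.P K) M j).Dom) (ψ : CPair (F.P K) 𝔸), ψ ∈ sp j Y → ‖old j Y ψ‖ ≤ A * Real.exp (-(κ * torusTreeLen Y.1))) →
      ∀ (X : (domSys (F.P K) M (k' + 1)).Dom) (φ : CPair (F.P K) 𝔸), φ ∈ sp (k' + 1) X → ∀ (Z : (domSys (F.P K) M (k' + 1)).Dom), Z.1 ⊆ X.1 → ∀ t ∈ terms L M Z,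
        DifferentiableOn ℂ (fun z => TF k' Z t z old φ) (D k') ∧ ∀ z ∈ D k', ‖TF k' Z t z old φ‖ ≤ weight L M c Z a t * Real.exp (a₅ * ((Z.1).card : ℝ)))
    (hprop : ∀ k' : ℕ, k' < Kr → ∀ i : ℕ, i < k' → ∀ (O : Set ℂ), IsOpen O → ∀ u ∈ D k', ∀ cv : ℂ → OlderTerms (F.P K) 𝔸 M k',
      (∀ (j : Fin (k' + 1)) (Y : (domSys (F.P K) M j).Dom) (ψ : CPair (F.P K) 𝔸), ψ ∈ sp j Y →
        DifferentiableOn ℂ (fun z => cv z j Y ψ) O ∧ ∀ z ∈ O, ‖cv z j Y ψ‖ ≤ A * Real.exp (-(κ * torusTreeLen Y.1))) →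
      ∀ (X : (domSys (F.P K) M (k' + 1)).Dom) (φ : CPair (F.P K) 𝔸), φ ∈ sp (k' + 1) X → ∀ (Z : (domSys (F.P K) M (k' + 1)).Dom), Z.1 ⊆ X.1 → ∀ t ∈ terms L M Z,
        DifferentiableOn ℂ (fun z => TF k' Z t u (cv z) φ) O ∧ ∀ z ∈ O, ‖TF k' Z t u (cv z) φ‖ ≤ weight L M c Z a t * Real.exp (a₅ * ((Z.1).card : ℝ)))
    (hpropV : ∀ k' : ℕ, k' < Kr → ∀ (O : Set ℂ), IsOpen O → ∀ cv : ℂ → OlderTerms (F.P K) 𝔸 M k',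
      (∀ (j : Fin (k' + 1)) (Y : (domSys (F.P K) M j).Dom) (ψ : CPair (F.P K) 𝔸), ψ ∈ sp j Y →
        DifferentiableOn ℂ (fun z => cv z j Y ψ) O ∧ ∀ z ∈ O, ‖cv z j Y ψ‖ ≤ A * Real.exp (-(κ * torusTreeLen Y.1))) →
      ∀ (X : (domSys (F.P K) M (k' + 1)).Dom) (φ : CPair (F.P K) 𝔸), φ ∈ sp (k' + 1) X → ∀ (Z : (domSys (F.P K) M (k' + 1)).Dom), Z.1 ⊆ X.1 → ∀ t ∈ terms L M Z,
        DifferentiableOn ℂ (fun z => V k' Z t (cv z) φ) O ∧ ∀ z ∈ O, ‖V k' Z t (cv z) φ‖ ≤ weight L M c Z a t * Real.exp (a₅ * ((Z.1).card : ℝ)))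
    (hcen : ∀ k' : ℕ, k' < Kr → ∀ old : OlderTerms (F.P K) 𝔸 M k',
      (∀ (j : Fin (k' + 1)) (Y : (domSys (F.P K) M j).Dom) (ψ : CPair (F.P K) 𝔸), ψ ∈ sp j Y → ‖old j Y ψ‖ ≤ A * Real.exp (-(κ * torusTreeLen Y.1))) →
      ∀ (X : (domSys (F.P K) M (k' + 1)).Dom) (φ : CPair (F.P K) 𝔸), φ ∈ sp (k' + 1) X → ∀ (Z : (domSys (F.P K) M (k' + 1)).Dom), Z.1 ⊆ X.1 → ∀ t ∈ terms L M Z,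
        ∀ z ∈ D k', ‖TF k' Z t z old φ - V k' Z t old φ‖ ≤ Mv * ‖z‖ ^ 2 * (weight L M c Z a t * Real.exp (a₅ * ((Z.1).card : ℝ))))
    (hMv : 0 < Mv) :
    ∀ (j : ℕ), j ≤ Kr → ∀ (g : ℕ → ℝ), g ∈ Window γ → ∀ (i : ℕ), i < j → ∀ (X : (domSys (F.P K) M j).Dom) (φ : CPair (F.P K) 𝔸), φ ∈ sp j X →
      ∀ z₀ ∈ D i, z₀ ≠ 0 → Mv * ‖z₀‖ ^ 2 ≤ 1 / 2 →
        ‖recTerm (GenTower.ofTerms L TF) (Function.update (fun n => ((g n : ℝ) : ℂ)) i z₀) j X φ -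
            recTerm (GenTower.ofTerms L (Function.update TF i fun Z t _ old φ => V i Z t old φ)) (fun n => ((g n : ℝ) : ℂ)) j X φ‖ ≤
          2 * (Mv * ‖z₀‖ ^ 2) * (A * Real.exp (-(κ * torusTreeLen X.1))) := by
  intro j hj g hg i hij X φ hφ z₀ hz₀ hz₀ne hq
  have hA6 : 0 ≤ c.α₆ * c.eps2 := mul_nonneg hN.hα₆.le hN.hε₀
  have hγ : 0 < γ := (hg 0).1.trans_le (hg 0).2
  -- letters of the interpolation
  set q : ℝ := Mv * ‖z₀‖ ^ 2 with hqdef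
  have hq0 : 0 < q := mul_pos hMv (pow_pos (norm_pos_iff.mpr hz₀ne) 2)
  set ρ : ℝ := γ + 1 with hρdef
  have hρ0 : 0 < ρ := by positivity
  set R : ℝ := ρ / q with hRdef
  have hR0 : 0 < R := div_pos hρ0 hq0
  have hRρ : R * q = ρ := div_mul_cancel₀ ρ hq0.ne'
  have hρR : ρ < R := by
    rw [hRdef, lt_div_iff₀ hq0]
    nlinarith
  have hγR : γ < R := by linarith
  -- the upgraded weight letter
  have hexp : ∀ (k' : ℕ) (Z : (domSys (F.P K) M (k' + 1)).Dom), Real.exp (a₅ * ((Z.1).card : ℝ)) ≤ Real.exp (a₅' * ((Z.1).card : ℝ)) := fun k' Z =>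
    le_trans (by linarith [Real.exp_pos (a₅ * ((Z.1).card : ℝ))]) (h2w k' Z)
  have hw_up : ∀ (k' : ℕ) (Z : (domSys (F.P K) M (k' + 1)).Dom) (t : TermLabel (F.P K) M k' L) (x : ℝ),
      x ≤ weight L M c Z a t * Real.exp (a₅ * ((Z.1).card : ℝ)) → x ≤ weight L M c Z a t * Real.exp (a₅' * ((Z.1).card : ℝ)) := fun k' Z t x hx =>
    hx.trans (mul_le_mul_of_nonneg_left (hexp k' Z) (weight_nonneg c Z a hA6 t))
  have hw_two : ∀ (k' : ℕ) (Z : (domSys (F.P K) M (k' + 1)).Dom) (t : TermLabel (F.P K) M k' L) (x : ℝ),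
      x ≤ 2 * (weight L M c Z a t * Real.exp (a₅ * ((Z.1).card : ℝ))) → x ≤ weight L M c Z a t * Real.exp (a₅' * ((Z.1).card : ℝ)) := fun k' Z t x hx =>
    hx.trans (by
      calc 2 * (weight L M c Z a t * Real.exp (a₅ * ((Z.1).card : ℝ))) = weight L M c Z a t * (2 * Real.exp (a₅ * ((Z.1).card : ℝ))) := by ring
        _ ≤ weight L M c Z a t * Real.exp (a₅' * ((Z.1).card : ℝ)) := mul_le_mul_of_nonneg_left (h2w k' Z) (weight_nonneg c Z a hA6 t))
  -- the uncentred bound of the centre at a bounded older-term family (from (S-226-T′) for `V` along a constant curve)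
  have hVb : ∀ k' : ℕ, k' < Kr → ∀ old : OlderTerms (F.P K) 𝔸 M k',
      (∀ (j : Fin (k' + 1)) (Y : (domSys (F.P K) M j).Dom) (ψ : CPair (F.P K) 𝔸), ψ ∈ sp j Y → ‖old j Y ψ‖ ≤ A * Real.exp (-(κ * torusTreeLen Y.1))) →
      ∀ (X : (domSys (F.P K) M (k' + 1)).Dom) (φ : CPair (F.P K) 𝔸), φ ∈ sp (k' + 1) X → ∀ (Z : (domSys (F.P K) M (k' + 1)).Dom), Z.1 ⊆ X.1 → ∀ t ∈ terms L M Z,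
        ‖V k' Z t old φ‖ ≤ weight L M c Z a t * Real.exp (a₅ * ((Z.1).card : ℝ)) := fun k' hk old hold X φ hφ Z hZ t ht =>
    ((hpropV k' hk univ isOpen_univ (fun _ => old) (fun j Y ψ hψ => ⟨differentiableOn_const _, fun _ _ => hold j Y ψ hψ⟩) X φ hφ Z hZ t ht).2 0 (mem_univ _))
  -- THE INTERPOLATION TOWER and its domain family
  set TFs : GenTermFun (F.P K) 𝔸 M L :=
    Function.update TF i (fun Z t s old φ => V i Z t old φ + (s / (ρ : ℂ)) * (TF i Z t z₀ old φ - V i Z t old φ)) with hTFs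
  set Ds : ℕ → Set ℂ := Function.update D i (ball (0 : ℂ) R) with hDs
  have hTFs_i : TFs i = fun Z t s old φ => V i Z t old φ + (s / (ρ : ℂ)) * (TF i Z t z₀ old φ - V i Z t old φ) := by rw [hTFs, Function.update_self]
  have hTFs_ne : ∀ k' : ℕ, k' ≠ i → TFs k' = TF k' := fun k' hk => by rw [hTFs, Function.update_of_ne hk]
  have hDs_i : Ds i = ball (0 : ℂ) R := by rw [hDs, Function.update_self]
  have hDs_ne : ∀ k' : ℕ, k' ≠ i → Ds k' = D k' := fun k' hk => by rw [hDs, Function.update_of_ne hk]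
  have hDso : ∀ i', IsOpen (Ds i') := fun i' => by
    by_cases h : i' = i
    · subst h; rw [hDs_i]; exact isOpen_ball
    · rw [hDs_ne i' h]; exact hDo i'
  have hDsw : ∀ (i' : ℕ), ∀ t ∈ Ioc (0 : ℝ) γ, ((t : ℝ) : ℂ) ∈ Ds i' := fun i' t ht => by
    by_cases h : i' = i
    · subst h
      rw [hDs_i, mem_ball, dist_zero_right, Complex.norm_real, Real.norm_eq_abs, abs_of_pos ht.1]
      exact ht.2.trans_lt hγR
    · rw [hDs_ne i' h]; exact hDw i' t ht
  -- the norm of the affine combination on the ball: at most twice the weight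
  have haff : ∀ (s : ℂ), ‖s‖ ≤ R → ∀ (x y w : ℂ) (wt : ℝ), ‖y‖ ≤ wt → ‖x - y‖ ≤ q * wt → ‖y + s / (ρ : ℂ) * (x - y)‖ ≤ 2 * wt := by
    intro s hs x y w wt hy hxy
    have hwt : 0 ≤ wt := (norm_nonneg _).trans hy
    have h1 : ‖s / (ρ : ℂ) * (x - y)‖ ≤ R / ρ * (q * wt) := by
      rw [norm_mul, norm_div, Complex.norm_real, Real.norm_eq_abs, abs_of_pos hρ0]
      exact mul_le_mul (div_le_div_of_nonneg_right hs hρ0.le) hxy (norm_nonneg _) (div_nonneg hR0.le hρ0.le)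
    have h2 : R / ρ * (q * wt) = wt := by
      rw [← hRρ]; field_simp
    calc ‖y + s / (ρ : ℂ) * (x - y)‖ ≤ ‖y‖ + ‖s / (ρ : ℂ) * (x - y)‖ := norm_add_le _ _
      _ ≤ wt + wt := add_le_add hy (h1.trans h2.le)
      _ = 2 * wt := by ring
  -- R1a §2 for the interpolation tower at the letter a₅′
  have H1 := holoBound_recTerm_ofTerms F K L TFs sp c hL hLc hN hA0 hr₁ hκ hrate hsmall hrenew Ds hDso hDsw Kr ?_ ?_
  rotate_left
  · -- (S-last-T′) for the interpolation tower
    intro k' hk old hold X' φ' hφ' Z hZ t ht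
    by_cases hki : k' = i
    · subst hki
      rw [hTFs_i, hDs_i]
      refine ⟨?_, fun s hs => ?_⟩
      · exact ((differentiableOn_const _).add ((differentiableOn_id.div_const _).mul (differentiableOn_const _)))
      · refine hw_two k' Z t _ (haff s ?_ _ _ 0 _ (hVb k' hk old hold X' φ' hφ' Z hZ t ht) (hcen k' hk old hold X' φ' hφ' Z hZ t ht z₀ hz₀))
        rw [mem_ball, dist_zero_right] at hs
        exact hs.le
    · rw [hTFs_ne k' hki, hDs_ne k' hki]
      obtain ⟨hd, hb⟩ := hlast k' hk old hold X' φ' hφ' Z hZ t ht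
      exact ⟨hd, fun z hz => hw_up k' Z t _ (hb z hz)⟩
  · -- (S-226-T′) for the interpolation tower
    intro k' hk i' hi' u hu cv hcv X' φ' hφ' Z hZ t ht
    have hcvb : ∀ z ∈ Ds i', ∀ (j : Fin (k' + 1)) (Y : (domSys (F.P K) M j).Dom) (ψ : CPair (F.P K) 𝔸), ψ ∈ sp j Y →
        ‖cv z j Y ψ‖ ≤ A * Real.exp (-(κ * torusTreeLen Y.1)) := fun z hz j Y ψ hψ => (hcv j Y ψ hψ).2 z hz
    by_cases hki : k' = i
    · subst hki
      have hi'ne : i' ≠ k' := Nat.ne_of_lt hi'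
      rw [hTFs_i]
      rw [hDs_i, mem_ball, dist_zero_right] at hu
      rw [hDs_ne i' hi'ne] at hcv hcvb ⊢
      obtain ⟨hVd, hVbd⟩ := hpropV k' hk (D i') (hDo i') cv hcv X' φ' hφ' Z hZ t ht
      obtain ⟨hTd, -⟩ := hprop k' hk i' hi' (D i') (hDo i') z₀ hz₀ cv hcv X' φ' hφ' Z hZ t ht
      refine ⟨hVd.add ((differentiableOn_const _).mul (hTd.sub hVd)), fun z hz => ?_⟩
      exact hw_two k' Z t _ (haff u hu.le _ _ 0 _ (hVbd z hz) (hcen k' hk (cv z) (hcvb z hz) X' φ' hφ' Z hZ t ht z₀ hz₀))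
    · rw [hTFs_ne k' hki]
      rw [hDs_ne k' hki] at hu
      obtain ⟨hd, hb⟩ := hprop k' hk i' hi' (Ds i') (hDso i') u hu cv hcv X' φ' hφ' Z hZ t ht
      exact ⟨hd, fun z hz => hw_up k' Z t _ (hb z hz)⟩
  -- the section of the interpolation tower in the mock coupling: holomorphic on the ball, bounded by `A e^{−κ d}`
  obtain ⟨-, hsec⟩ := H1 j hj g hg X φ hφ
  obtain ⟨hhol, hbd⟩ := hsec i hij
  rw [hDs_i] at hhol hbd
  set gc : ℕ → ℂ := fun n => ((g n : ℝ) : ℂ) with hgc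
  set Φ : ℂ → ℂ := fun s => recTerm (GenTower.ofTerms L TFs) (Function.update gc i s) j X φ with hΦ
  -- its values at the two mock couplings
  have hΦρ : Φ (ρ : ℂ) = recTerm (GenTower.ofTerms L TF) (Function.update gc i z₀) j X φ := by
    refine recTerm_ofTerms_congr_step F K L i hTFs_ne (fun n hn => by rw [Function.update_of_ne hn, Function.update_of_ne hn]) (fun Z t old φ => ?_) j X φ
    rw [hTFs_i, Function.update_self, Function.update_self]
    have hρc : (ρ : ℂ) ≠ 0 := Complex.ofReal_ne_zero.mpr hρ0.ne'
    field_simp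
    ring
  have hΦ0 : Φ 0 = recTerm (GenTower.ofTerms L (Function.update TF i fun Z t _ old φ => V i Z t old φ)) gc j X φ := by
    refine recTerm_ofTerms_congr_step F K L i (fun k' hk => by rw [hTFs_ne k' hk, Function.update_of_ne hk])
      (fun n hn => by rw [Function.update_of_ne hn]) (fun Z t old φ => ?_) j X φ
    rw [hTFs_i, Function.update_self, Function.update_self]
    simp
  -- the Schwarz lemma on `ball 0 R`: the section maps the ball into the closed `2A e^{−κd}`-ball about its value at `0`
  have hB0 : ‖Φ 0‖ ≤ A * Real.exp (-(κ * torusTreeLen X.1)) := hbd 0 (mem_ball_self hR0)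
  have hmaps : MapsTo Φ (ball (0 : ℂ) R) (closedBall (Φ 0) (2 * (A * Real.exp (-(κ * torusTreeLen X.1))))) := fun s hs => by
    rw [mem_closedBall, dist_eq_norm]
    calc ‖Φ s - Φ 0‖ ≤ ‖Φ s‖ + ‖Φ 0‖ := norm_sub_le _ _
      _ ≤ A * Real.exp (-(κ * torusTreeLen X.1)) + A * Real.exp (-(κ * torusTreeLen X.1)) := add_le_add (hbd s hs) hB0
      _ = 2 * (A * Real.exp (-(κ * torusTreeLen X.1))) := by ring
  have hρball : ((ρ : ℝ) : ℂ) ∈ ball (0 : ℂ) R := by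
    rw [mem_ball, dist_zero_right, Complex.norm_real, Real.norm_eq_abs, abs_of_pos hρ0]
    exact hρR
  have key := Complex.dist_le_div_mul_dist_of_mapsTo_ball hhol hmaps hρball
  rw [dist_eq_norm, dist_zero_right, Complex.norm_real, Real.norm_eq_abs, abs_of_pos hρ0, hΦρ, hΦ0] at key
  calc ‖recTerm (GenTower.ofTerms L TF) (Function.update gc i z₀) j X φ -
          recTerm (GenTower.ofTerms L (Function.update TF i fun Z t _ old φ => V i Z t old φ)) gc j X φ‖
      ≤ 2 * (A * Real.exp (-(κ * torusTreeLen X.1))) / R * ρ := key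
    _ = 2 * (Mv * ‖z₀‖ ^ 2) * (A * Real.exp (-(κ * torusTreeLen X.1))) := by
        rw [← hqdef, hRdef]
        field_simp

end YMDAG.N22.W1

end
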